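import Mathlib
import HarnessLib
import HarnessLib.Audit
import Summits.MatrixMultiplication.Statement
import Literature.Computability.AlgebraicComplexity.FlatteningBound
import Literature.Computability.AlgebraicComplexity.AsymptoticSpectrum

/-!
Route: EPRFaces

CLOSED (exhausted) 2026-08-17T10:04:18Z by planner-rbadge-MatrixMultiplication-EPRFaces-159198fd-g3-0 — reason: exhausted — note: route-repair (badge seat g3): CLOSED EXHAUSTED per the route's own KILL CRITERIA ("E proved first ⇒ the route contracts to B ⇔ ω = 2"). CENSUS — Tried/landed: E = PerfectAmortisation stmt-10893 PROVED (perfectAmortisation_proof, p149012; first-power CW_q laser, q = k+2); negative twin ModuleRankGrow. The file is kept as the record of this route; refuted decls are indexed as negative knowledge (`ledger negatives`).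

# Route EPRFaces — omega - 2 = amortisation excess e(inf) + depth d of the maximiser below the EPR
faces; perfect amortisation and a face maximiser give omega = 2

It suffices to show X = B ∧ E (card epr-faces-amortised-module-border-rank, spine). Write ω(1,1,k)
for the exponent of
⟨n,n,n^k⟩ (an n × n matrix times an n × n^k matrix, R = tensor rank): ω(1,1,k) = inf {β |
R(⟨n,n,n^k⟩) = O(n^β)} — this
is the tree's omegaRect ℂ 1 1 k on the nose, since ⌈n^k⌉ = n^k for natural k. REPAIR rev 1
(2026-08-15): every item is
filed in this RANK FORM, directly over tensorRank (matMulTensor ℂ n n (n ^ k)) =O n^β and omega ℂ,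
so that the route
rests only on proved vocabulary (MatrixMultiplicationExponent, FlatteningBound, AsymptoticSpectrum)
and no vendored
record table rides into its cone; each restated item is equivalent to its ω(1,1,k) reading by
csInf_le / le_csInf /
exists_lt_of_csInf_lt and upward closure (rectAdmissibleExponents nonempty and bounded below, both
in the tree).
e(k) := ω(1,1,k) − k − 1 ∈ [0, ω − 2] is nonincreasing in k (flattening and blocking, both proved in
the tree).
E (PERFECT AMORTISATION, the card's face statement in form (i)): e(∞) := lim_k e(k) = 0 — an n × n
matrix applied to
n^k vectors costs n^{1+o(1)} per vector for k large; filed as ∀ ε > 0 ∃ k ≥ 1, R(⟨n,n,n^k⟩) =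
O(n^{k+1+ε})
(⟺ ∀ ε ∃ k, ω(1,1,k) ≤ k + 1 + ε; the ε-slack is absorbed by the quantifiers). B (FACE MAXIMISER): ∀
k ≥ 1, every β
with R(⟨n,n,n^k⟩) = O(n^β) has ω + (k − 1) ≤ β, i.e. ω + (k − 1) ≤ ω(1,1,k) — ⟨n,n,n^k⟩ admits no
asymptotic economy
over n^{k−1} square products; in Strassen's chart of the spectrum of matrix shapes (every universal
spectral point
is F(⟨a,b,c⟩) = a^{l₁} b^{l₂} c^{l₃}, (lᵢ) ∈ [0,1]³, ω = max Σ lᵢ) B says some ω-maximising point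
lies on the EPR
face l₃ = 1. The identity behind the route: ω − 2 = e(∞) + d with e(∞) = h − 1, d = ω − 1 − h ≥ 0,
where
h := lim_k (ω(1,1,k) − k) = max{l₁ + l₂ : (l₁,l₂,1) ∈ log Δ_MM}; E kills the first term, B the
second, and ω = 2
gives both back (support Converse), so nothing is lost.
Lean: `(∀ k : ℕ, 1 ≤ k → ∀ β : ℝ, ((fun n : ℕ =>
(Literature.Computability.AlgebraicComplexity.tensorRank
(Literature.Computability.AlgebraicComplexity.matMulTensor ℂ n n (n ^ k)) : ℝ)) =O[Filter.atTop] fun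
n : ℕ => (n : ℝ) ^ β) → Literature.Computability.AlgebraicComplexity.omega ℂ + ((k : ℝ) - 1) ≤ β) ∧
(∀ ε : ℝ, 0 < ε → ∃ k : ℕ, 1 ≤ k ∧ (fun n : ℕ =>
(Literature.Computability.AlgebraicComplexity.tensorRank
(Literature.Computability.AlgebraicComplexity.matMulTensor ℂ n n (n ^ k)) : ℝ)) =O[Filter.atTop] fun
n : ℕ => (n : ℝ) ^ ((k : ℝ) + 1 + ε))`

## Assembly
The deciding theorem `closes : FaceMaximiser → PerfectAmortisation → MatrixMultiplication` is PROVED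
in the route file
(six lines of real arithmetic): given ε > 0, E yields k ≥ 1 with R(⟨n,n,n^k⟩) = O(n^{k+1+ε/2}); B
applied to that
admissible exponent gives ω + (k − 1) ≤ k + 1 + ε/2, so ω < 2 + ε for every ε > 0, i.e. ω ≤ 2; and 2
≤ ω is the
flattening bound (FlatteningBound.omega_two_le, proved); ω = 2 = MatrixMultiplication
(MatrixMultiplication_iff). The
item `Assembly` records the same implication as a Prop.

Rationale: WHY THIS LINE. Strassen's spectrum of matrix shapes Δ_m (Strassen1988, Strassen1991;
BurgisserClausenShokrollahi1997 Notes p. 456 and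
Problem 15.4 p. 452: log Δ_m ⊇ Γ = conv{(1,1,0),(1,0,1),(0,1,1)}, star-shaped w.r.t. Γ,
log-convexity open) makes
ω = max_F (l₁+l₂+l₃) a maximum over a compact set, and the k → ∞ end of the rectangular exponents
(LottiRomani1983,
LeGall2012 §1 eq. (1): k + 1 ≤ ω(1,1,k) ≤ k − 1 + ω, convexity) reads off exactly the side faces {lᵢ
= 1}: this
splits ω − 2 into two non-negative defects, an AMORTISATION excess e(∞) (a question about one EPR
pair: can a matrix be
applied to a stream of vectors at no loss — the module / pencil regime ⟨n,n,N⟩, N → ∞, with its own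
small rigid
objects β(n) = inf_N bR(⟨n,n,N⟩)/N, β(2) ∈ [3, 22/7], LandsbergOttaviani2015, arXiv:1509.08323) and
a LOCATION defect
d (are the ω-maximising "dark" spectral points interior or on a face). Each factor is strictly
weaker than ω = 2 as
far as anyone knew at open, each has its own technology (laser method at k → ∞ and module border
rank for E; spectral
structure / a lossless square←rectangular transfer for B), and B alone already pins ω ≤ 1 + (u_k −
k) = 2.198809 from
the vendored VXXZ2024 row k = 3 (support Dichotomy; ≈ 2.1668 with LeGall2012 Table 1, k = 5, as read
in the card).
Imported: real semi-algebraic duality of preordered semirings (Strassen's spectral theorem, proved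
in the tree as
strassen_duality_asymptoticRank_holds), the amortised-complexity viewpoint, and for the refutation
face the algebraic
geometry of pencils / secant-versus-cactus equations (arXiv:2602.12762). No prior route touches the
k → ∞ end:
RectangularAlpha works at the vertex (1,1,0) (α, shapes (1,a,1), a < 1), AsymptoticSpectrum at the
single tensor
⟨2,2,2⟩. STATUS AFTER REPAIR rev 2 (2026-08-17). The amortisation half is SETTLED: E =
PerfectAmortisation (stmt-10893) is
PROVED in the tree (Theorems/ShapeSubmodularityPerfectAmortisation.lean, perfectAmortisation_proof:
the first-power laser
method on CW_q with the far-rectangular joint type, Schönhage's rectangular asymptotic sum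
inequality, q = k + 2, k → ∞ —
Coppersmith 1982 / LottiRomani1983 Prop. 4.1 in modern dress; e(k) ≤ f(k,k+2) − k − 1 → 0), and with
it every support
(Converse, Dichotomy, RungTwoConsequences, ModuleGrowthRefutes, SpectralFaceForm) and the Assembly
item are proved (independently, 2026-08-16); the
negative twin ModuleRankGrowth (stmt-7244, ex-#4) is consequently FALSE (not_ModuleRankGrowth =
ModuleGrowthRefutes ∘ E) and
was DROPPED at rev 2 as settled negative knowledge (ledger negatives). So e(∞) = 0, h = 1, d = ω −
2: the route has
CONTRACTED, exactly as its kill criteria foresaw, to "FaceMaximiser ⇔ ω = 2" (→ is `closes` with the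
proved E, ← is the
proved Converse): the LOCATION of an ω-maximising universal spectral point — on the EPR face l₃ = 1
or interior — is now
the whole problem, and RectExponentTwoEqThree stays as the constructive rung (alone ω ≤ 9/4; with B,
ω = 2).

RANKED CRUXES. All items are filed in RANK FORM (repair rev 1): R(⟨n,n,n^k⟩) := tensorRank
(matMulTensor ℂ n n (n^k)), "β admissible for (1,1,k)" := R(⟨n,n,n^k⟩) = O(n^β), and ω(1,1,k) = inf
of the admissible β (= omegaRect ℂ 1 1 k, ⌈n^k⌉ = n^k). #0 Thesis (target, open) — X = B ∧ E: (B)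
for every natural k ≥ 1 and every admissible β for (1,1,k), ω_ℂ + (k − 1) ≤ β; (E) for every ε > 0
some natural k ≥ 1 has k + 1 + ε admissible for (1,1,k). Since rev 2, E is a theorem, so Thesis ⟺
FaceMaximiser (And.intro with perfectAmortisation_proof). (why it might fail: ω > 2 now forces ¬B
outright — every ω-maximising spectral point interior, dark points undercounting all three EPR
pairs.) [Strassen1988, LeGall2012, BurgisserClausenShokrollahi1997]
#2 PerfectAmortisation (crux, PROVED 2026-08-17 by
Theorems.PerfectAmortisation.perfectAmortisation_proof) — E: ∀ ε > 0 ∃ k ≥ 1, R(⟨n,n,n^k⟩) =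
O(n^{k+1+ε}) (⟺ inf_k [ω(1,1,k) − k − 1] = 0). Proof route taken: CW_q^{⊗N} ⊵ ⟨V⟩ ⊗ ⟨a,a,a^k⟩ with
(q+2)^N ≤ V·a^{f(k,q)+δ}, f(k,q) = (k+2)(log(q+2) − h(1/(k+2)))/log q, then ω(1,1,k) ≤ f(k,q)
(mul_rpow_omegaRect_le_asymptoticRank, asymptoticRank_bigCwTensor_le) and f(k,k+2) − k − 1 → 0;
RectangularBarrier does not bite because ζ^{(1/2,0,1/2)}(CW_q) = q + 2 (the cap on the excess itself
tends to 0 as q = k + 2 → ∞). [LeGall2012, LeGallUrrutia2018, VassilevskaWilliamsXuXuZhou2024,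
LottiRomani1983, doi:10.1006/jcom.1998.0476]
#3 FaceMaximiser (crux, OPEN — now the deciding crux: B ⇔ ω = 2) — B: for every natural k ≥ 1 and
every admissible β for (1,1,k), ω_ℂ + (k − 1) ≤ β, i.e. ω + (k − 1) ≤ ω(1,1,k) (the reverse
inequality is blocking, omegaRect_one_one_le_add): ⟨n,n,n^k⟩ has no asymptotic economy over n^{k−1}
square products, d = 0. Chart form (support SpectralFaceForm, proved): some universal spectral point
F with F(⟨2,2,2⟩) = 2^ω (a maximiser) has F(⟨1,1,2⟩) = 2, i.e. lies on the EPR face l₃ = 1. By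
convexity (omegaRect_convexOn_middle_holds, proved) the single value k = 2, ω(1,1,2) = ω + 1,
already gives all k. [difficulty: open-problem; equivalent to the summit since rev 2 — why easier:
it is a LOCATION statement about one maximiser in Strassen's compact chart, attackable by structure
theory of log Δ_m (faces, star-shapedness, relative universality à la CVZ) and by a lossless
square←rectangular transfer at the single shape (1,1,2), neither of which is an upper-bound-on-ω
computation] (why it might fail: if ω > 2 every maximiser may be interior; B forces ω ≤ 1 + (u_k −
k) ≤ 2.198809 (vendored k = 3 row, Dichotomy), so B is false once ω > 2.1989, and no lossless
square←rectangular transfer is known.) [Strassen1988, Strassen1991, BurgisserClausenShokrollahi1997,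
doi:10.1006/jcom.1998.0476, VassilevskaWilliamsXuXuZhou2024]
SETTLED NEGATIVE EDGE (ex-#4, dropped at rev 2, kept in `ledger negatives`): ModuleRankGrowth
(stmt-MatrixMultiplication-7244: ∃ c > 0, n₀, ∀ n ≥ n₀, R(⟨n,n,N⟩) ≥ n^{1+c}·N for all large N —
superlinear module rank per vector) is FALSE:
`Summit.MatrixMultiplication.MatrixMultiplication.Theorems.PerfectAmortisation.not_ModuleRankGrowth`
(Theorems/EPRFacesModuleRankGrowthRefutation.lean, p149445, refuted-substantive: every c > 0 fails,
the witness being E itself through ModuleGrowthRefutes; no repair wanted — it was the route's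
explicitly filed refutation surface, never a hypothesis of `closes`). The module regime keeps only
its quantitative questions (β(2) ∈ [3, 22/7], β(n) vs (2+δ)n), which no longer bear on this route.
PROVER NOTE (migrate item for that Theorems file): since rev 2 the constant
`…Theses.EPRFaces.ModuleRankGrowth` is no longer rendered in the route file, so the refutation
module must re-declare `def ModuleRankGrowth : Prop := <ledger signature of stmt-7244, verbatim>` in
namespace `Summit.MatrixMultiplication.MatrixMultiplication.Theses.EPRFaces` ahead of
`not_ModuleRankGrowth` (pattern of
Theorems/DesignFlatteningSeparableDesignsMultiplicativeRefutation.lean); the complete fixed module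
(lean check rc 0, 0 sorries, theorem text unchanged) is attached as evidence
`EPRFacesModuleRankGrowthRefutation.fixed.lean` on stmt-MatrixMultiplication-7244
(2026-08-17T09:30Z) — land it as is. [LandsbergOttaviani2015, arXiv:1509.08323, arXiv:2602.12762,
Blaser2013]
#5 RectExponentTwoEqThree (crux, OPEN) — the k = 2 rung of the card's ladder: ∀ ε > 0, R(⟨n,n,n²⟩) =
O(n^{3+ε}), i.e. ω_ℂ(1,1,2) ≤ 3 (hence = 3 by flattening), i.e. R̃(⟨2,2,4⟩) = 8: an n × n by n × n²
product in n^{3+o(1)} operations. Implies E (moot now) and ω ≤ 9/4 by the asymptotic sum inequality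
for the single summand (support RungTwoConsequences, proved); together with B it gives ω = 2, and it
is NECESSARY for ω = 2 (blocking ω(1,1,2) ≤ ω + 1, omegaRect_one_one_le_add, plus upward closure of
the admissible exponents). [difficulty: open-problem] (why it might fail: the record is ω(1,2,1) ≤
3.250035 (ADVXXZ2025 Table 1); CLLZ Table 1 bars every CW_q T-method, q ≤ 14, below 3.0626, so a
non-CW carrier is needed; and it forces ω ≤ 2.25, below everything certified so far.)
[AlmanDuanVassilevskaWilliamsXuXuZhou2025, ChristandlLeGallLysikovZuiddam2025, LeGall2012,
doi:10.1006/jcom.1998.0476]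
#9 Converse (support, PROVED: Theorems.converse_proof) — ω = 2 → B ∧ E: the factorisation loses
nothing. B: the flattening bound R(⟨n,n,n^k⟩) ≥ n·n^k (FlatteningBound,
mul_le_tensorRank_matMulTensor family) makes every admissible β ≥ k + 1 = ω + k − 1; E with k = 1: ω
= inf admissibleExponents = 2 gives an admissible β < 2 + ε (exists_lt_of_csInf_lt), hence 2 + ε
admissible, reindexed n^1 = n. [LeGall2012, Blaser2013]
#9 Dichotomy (support, PROVED: Theorems.dichotomy_proof) — record-free: IF the VXXZ2024 row κ = 3
holds in rank form (∀ ε > 0, R(⟨n,n,n³⟩) = O(n^{4.198809+ε}), kept as an EXPLICIT hypothesis so that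
no vendored table enters the route's cone) and B holds, then ω ≤ 2.198809 (k = 3, β = 4.198809 + ε,
ε → 0); contrapositively ω > 2.1989 forces every ω-maximising spectral point to be interior.
[VassilevskaWilliamsXuXuZhou2024, LeGall2012]
#9 RungTwoConsequences (support, PROVED: Theorems.rungTwoConsequences_proof) — rung → ω ≤ 9/4 ∧ E:
from R(⟨n,n,n²⟩) = O(n^{3+ε}) and the single-summand asymptotic sum inequality (n·n·n²)^{ω/3} ≤
R̃(⟨n,n,n²⟩) ≤ R(⟨n,n,n²⟩) get 4ω/3 ≤ 3 + ε for every ε, so ω ≤ 9/4; the E-half is the rung itself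
at k = 2. [AlmanDuanVassilevskaWilliamsXuXuZhou2025, Blaser2013]
#9 ModuleGrowthRefutes (support, PROVED: Theorems.ModuleGrowthRefutes_proof) — (∃ c > 0 … n^{1+c}·N
≤ R(⟨n,n,N⟩)) → ¬E ∧ ¬(ω = 2): at FIXED n ≥ n₀ split the last slot, R(⟨n,n,N⟩) ≤
⌈N/n^k⌉·R(⟨n,n,n^k⟩), so an admissible β for (1,1,k) at that n gives n^{1+c}·N ≤ (N/n^k + 1)·C n^β
for all large N, hence β ≥ k + 1 + c for every k with the same c; ε := c/2 contradicts E, and k = 1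
gives ω ≥ 2 + c. With E proved this is exactly what refutes ModuleRankGrowth. [Blaser2013,
LeGall2012]
#9 SpectralFaceForm (support, PROVED: Theorems.spectralFaceForm_proof) — the chart dictionary for B:
(∃ a universal spectral point F over ℂ with F(⟨2,2,2⟩) = 2^ω and F(⟨1,1,2⟩) = 2) ↔ B. (→)
F(⟨2^m,2^m,2^{mk}⟩) = (F(⟨2,2,2⟩)·F(⟨1,1,2⟩)^{k−1})^m = 2^{m(ω+k−1)} by multiplicativity and
reindexing, and F ≤ R̃ ≤ R, so an admissible β for (1,1,k) satisfies 2^{m(ω+k−1)} ≤ C·2^{mβ} for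
large m, i.e. ω + k − 1 ≤ β; (←) duality part 2 gives a maximiser F at ⟨2,2,4⟩ with F(⟨2,2,4⟩) =
R̃(⟨2,2,4⟩) = 2^{ω(1,1,2)} ≥ 2^{ω+1} under B, while F(⟨2,2,4⟩) = F(⟨2,2,2⟩)·F(⟨1,1,2⟩) ≤ 2^ω·2,
forcing both equalities. [Strassen1988, ChristandlVranaZuiddam2023,
AlmanDuanVassilevskaWilliamsXuXuZhou2025]

TWO-LAYER PLAN. Foreseen glued splits (none filed now; the E-side splits LaserTail /
FaceUniversality and the BorderGrowth split
of the dropped negative twin are moot since rev 2). The k = 2 NORMAL FORM of B is already LANDED by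
the live line
(Theorems/EPRFacesFaceMaximiserNormalForm.lean: faceMaximiser_iff_faceAtTwo — B ⟺ B₂ := every
admissible β for (1,1,2) has
ω + 1 ≤ β; faceMaximiser_iff_omegaRect_two — B ⟺ ω(1,1,2) = ω + 1; convexity stub
EPRFacesFaceMaximiserStubConvexLift.lean,
LottiRomani1983 §1), so any split of FaceMaximiser sits BELOW B₂: FaceMaximiser ⇐ B₂ ⇐ {a lossless
square←rectangular
transfer at the one shape (1,1,2), i.e. R̃(⟨2,2,4⟩) = 2·R̃(⟨2,2,2⟩); or, in chart form
(SpectralFaceForm, proved ↔), a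
maximiser F of F(⟨2,2,2⟩) with F(⟨1,1,2⟩) = 2 from a structure statement on log Δ_m};
RectExponentTwoEqThree ⇐ a
rectangular STPP / group-theoretic construction of shape (m,m,m²), or a non-CW carrier tensor with a
rectangular value
certificate (kit-checkable per candidate).

KILL CRITERIA. The E-side kill is spent: ModuleRankGrowth is refuted and E proved, so the only
refutation left inside the route is
a certified interior maximiser — ¬FaceMaximiser, i.e. ω(1,1,k) < ω + k − 1 for some k, which since
rev 2 is EQUIVALENT to
ω > 2 (B ⇔ ω = 2 by closes + Converse + E) and would close the route `refuted:FaceMaximiser` and the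
summit conjunct
negatively with it; RectExponentTwoEqThree refuted (ω(1,1,2) > 3) likewise implies ω > 2 (it is
necessary under ω = 2). No
refutation inside this route is cheaper than ω ≠ 2 — the remaining cruxes are necessary conditions —
so the route now lives
or dies with the location question; if FaceMaximiser is proved the summit closes the same day
(closes), and ω ≤ 2.198809
(Dichotomy) is not even an intermediate stop any more. AThesis of route AsymptoticSpectrum proved
moots everything; a proof
of ω = 2 by any other route proves B (Converse).

NOT DECOMPOSED YET. Any structure theory of log Δ_m beyond star-shapedness that constrains WHERE the
maximum of l₁ + l₂ + l₃ is
attained (children of FaceMaximiser: relative universality on the face l₃ = 1 after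
ChristandlVranaZuiddam2023; whether the
set of maximisers is a face of the compact convex hull; a lossless square←rectangular transfer
⟨n,n,n²⟩ ↝ n copies of
⟨n,n,n⟩ at the level of asymptotic rank, i.e. R̃(⟨2,2,4⟩) = 2·R̃(⟨2,2,2⟩) — the shared-matrix
product must be asymptotically
as expensive as two independent square products; the restriction ⟨2,2,2⟩ ⊕ ⟨2,2,2⟩ ≥ ⟨2,2,4⟩ gives
only "≤", and the
missing "≥" is the whole content); which carrier tensors outside CW_q could certify ω(1,1,2) = 3
(children of
RectExponentTwoEqThree: rectangular STPP families, cyclic-group constructions of shape (m,m,m²));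
the exact constants
β(2) ∈ [3, 22/7], β(3) ∈ [5, 20/3] of the module regime are now context only. All are layer-2, after
a crux moves; the
live prover line on FaceMaximiser (Cruxes/FaceMaximiser, Theorems/EPRFacesFaceMaximiser*.lean) owns
the first split proposal.

CHEAPEST FALSIFIER. The LOOKUP of rev 1 is half-answered by the tree itself: "E" is now a theorem
(perfectAmortisation_proof), hence
"B ⇔ ω = 2" IS a theorem of the tree (closes, Converse) — the factorisation has collapsed onto the
location question, as
the rev-1 falsifier anticipated ("if E is proved first the route contracts to B ⇔ ω = 2"). What
remains cheap: (i) LOOKUP —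
is there a published structural reason forcing an ω-maximising point of Strassen's chart OFF the
side faces when ω > 2, or
onto them unconditionally (Strassen1991 §§ on Δ_m, BCS Problem 15.4 notes pp. 456–457, Huang–Pan
1998 §8.1, AlmanLi2026 §8
relativised calculus, ChristandlVranaZuiddam2023 universal points)? Either answer decides how B can
be attacked; searched
at open and at the rev-1 audit (LeGall2012 §1, LeGallUrrutia2018 §1, BCS pp. 452–457 read; hybrid
search over 5.26 M held
chunks) and not found. (ii) NUMERIC READING — with the landed normal form B ⟺ ω(1,1,2) = ω + 1 and
the record transfer
omega_le_of_faceMaximiser, B ⟹ ω ≤ 3.250035 − 1 = 2.250035 (ADVXXZ2025 row k = 2) and ω ≤ 2.198809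
(VXXZ2024 row k = 3,
Dichotomy): any certified lower bound ω > 2.1988 — indeed any ω > 2, since B ⇔ ω = 2 now — refutes
B, and nothing cheaper
than the summit's own negation exists inside the route. The rev-1 kit computation (k → ∞ asymptote
of the CW_q programme)
is moot: E was proved analytically with q = k + 2.

NUMBERS. k + 1 ≤ ω(1,1,k) ≤ ω + k − 1 (tree, proved); e(∞) = 0, h = 1 (tree, proved at rev 2:
ω(1,1,k) ≤ f(k,q) =
(k+2)(log(q+2) − h(1/(k+2)))/log q for every q ≥ 2, and f(k,k+2) − k − 1 → 0). Vendored rows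
(vxxz2024Table, advxxz2025Table,
over ℂ): ω(1,2,1) ≤ 3.250385 / 3.250035, ω(1,2.5,1) ≤ 3.720468, ω(1,3,1) ≤ 4.198809; hence e(2) ≤
0.250035, e(3) ≤ 0.198809,
and B ⇒ ω ≤ 2.198809; LeGallUrrutia2018 §1: ω(3) ≤ 4.199712 (improving LeGall2012's 4.207372). CLLZ
Table 1 (vendored
cllz2025OmegaTwoTable): CW_q T-methods certify ω(2) no lower than 3.0626 (q = 2) … 3.1714 (q = 14).
Module regime (context
only since rev 2): n ≤ β(n) ≤ ρ(n) ≤ R(⟨n,n,n⟩)/n; ρ(2) = 7/2 if R(⟨2,2,N⟩) = ⌈7N/2⌉ (Hopcroft–Kerr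
1971 / Alekseyev 1985, as
usually quoted; not re-read here); β(n) ≥ 2n − 1 (Koszul flattening, LandsbergOttaviani2015); β(2) ∈
[3, 22/7]
(arXiv:1509.08323 p. 5); by E, ρ(n) ≤ R(⟨n,n,n^k⟩)/n^k gives log_n ρ(n) → 1 as n → ∞ (the module
rank per vector is
n^{1+o(1)}, consistent with not_ModuleRankGrowth), while the constants at each fixed n stay open.
Items after rev 2: 10 (1 target open; 3 cruxes — PerfectAmortisation proved, FaceMaximiser open,
RectExponentTwoEqThree
open; 5 support all proved; 1 assembly proved) + the proved deciding theorem `closes (hB) (hE)`; 1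
dropped (ModuleRankGrowth,
refuted).

DEFINITION REQUESTS. None required: every statement is over tensorRank, matMulTensor, omega
(MatrixMultiplicationExponent),
SpectralMap, IsUniversalSpectralPoint (AsymptoticSpectrum) — all exist and are fact-free or proved.
The ω(1,1,k) reading uses
omegaRect (RectangularExponent*.lean) only inside proofs, never in a statement. Optional later
conveniences (not filed):
moduleBorderRank n := inf_N algBorderRank(⟨n,n,N+1⟩)/(N+1) (β) and amortisationExcess k := omegaRect
ℂ 1 1 k − k − 1.
HYGIENE SUGGESTION (operator/librarian): move RectangularExponent.lean §Records (the five vendored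
tables) into a sibling
RectangularExponentRecords.lean so that omegaRect itself has a clean cone.

Novelty: Searches (2026-08-15): `lit frontier MatrixMultiplication --since 2022` (30 rows; relevant
neighbours doi:10.1090/bull/1880,
arXiv:2605.21738, arXiv:2601.08119, arXiv:2601.21553, arXiv:2602.12762 — none on the k → ∞ end or
maximiser location);
`lit galaxy search "rectangular matrix multiplication" --star all` (12 rows: Landsberg GCT book, von
zur Gathen–Gerhard,
algorithmic applications; 0 on amortisation limits); galaxy "matrix-vector products amortized" /
"spectrum of matrix
shapes" / "border rank of matrix multiplication tensor n x n x N" (0 rows each); `lit search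
--hybrid "exponent of
rectangular matrix multiplication for large k" --no-graph` (10 docs; BCS 1997 pp. 410–458 the only
substantive hit —
read pp. 452–457: Δ_m chart, Problem 15.4, Brockett–Dobkin R(⟨h,h,log h⟩) = h² + o(h²)); `lit read
arxiv:1204.1111`
(LeGall2012 §1: eq. (1), convexity, no limit statement) and `lit read arxiv:1708.05622`
(LeGallUrrutia2018 §1); plain
`lit search` / `lit vsearch` were unavailable (searchd rc 75 / graph reset, 4 attempts); plus the
card's audited log
(refuter novelty audit 2026-08-15: BCS p. 456 and Landsberg–Ryder p. 5 verified, arXiv sweeps 0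
relevant).
Nearest prior art found: Strassen1988 / Strassen1991 with BurgisserClausenShokrollahi1997 p. 456
(the chart Δ_m,
star-shapedness, Problem 15.4); LottiRomani1983 + LeGall2012 §1 (k + 1 ≤ ω(1,1,k) ≤ k − 1 + ω,
convexity, each k treated
separately); ChristandlLeGallLysikovZuiddam2025 (the same coordinates log₂ F(⟨1,1,2⟩) used as  [refs: 10.1090/bull/1880, 10.1006/jcom.1998.0476, 2605.21738, 2601.08119, 2601.21553, 2602.12762, 1204.1111, 1708.05622, doi:10.1090/bull/1880, arxiv:1204.1111, arxiv:1708.05622, doi:10.1006/jcom.1998.0476, LeGall2012, LeGallUrrutia2018, Strassen1988, Strassen1991, BurgisserClausenShokrollahi1997, LottiRomani1983, ChristandlLeGallLysikovZuiddam2025]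

Barriers (technique_class: asymptotic-spectrum-faces, rectangular-mm, module-rank): - technique_class: asymptotic-spectrum-faces, rectangular-mm, module-rank
- Literature.Barriers.MatrixMultiplication.RectangularBarrier: met only by T-method PROOFS of cruxes
2 and 5 on CW_q. For RectExponentTwoEqThree it bites: cllz2025OmegaTwoTable bars ω̂(2) < 3.0626 …
3.1714 for q = 2 … 14, so that crux needs a carrier outside CW_q (stated in its why-line). For
PerfectAmortisation (p → ∞) the adequate-F bound of Thm. 3.15 at θ₁ = 0 is the trivial p + 1,
because ζ^{(1/2,0,1/2)}(CW_q) = q + 2 (both outer marginals uniform: P uniform on {(i,0,i)} ∪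
{(0,0,q+1),(q+1,0,0)}), so the catalogued barrier does NOT exclude certifying E through CW_q;
whether the laser method actually does is a layer-2 computation, not assumed.
- Literature.Barriers.MatrixMultiplication.UniversalMethodBarrier: not met by the route's own steps
(nothing is certified through a fixed intermediate tensor). Interaction recorded for crux 3: under B
the true ω is ≤ 1 + (u_k − k) — 2.198809 with the vendored k = 3 row, ≈ 2.1668 with LeGall2012's k =
5 row as read in the card, i.e. at or below Alman's 2.16805 floor for every CW_q — so if B holds no
universal-method analysis of a CW_q can ever be tight, and a proof of B (a LOWER bound on ω(1,1,k)
relative to ω, a lossless square←rectangular transfer) lies outside degeneration +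
asymptotic-sum-inequality bookkeeping, which only produces upper bounds. That is the bet, stated
openly.
- Literature.Barriers.MatrixMultiplication.IrreversibilityBarrier: a fixed intermed

Novelty grade: new-combination — ROUTE REVIEW (refuter rreview-2de8a21e-0): KEEP OPEN; new-combination (agrees with card audit g2-0). X = B ∧ E; Assembly B→E→MatrixMultiplication concludes the root Statement decl ✓ (candidate attached by g40-34); Converse ω=2→B∧E, so X ⟺ ω=2: a SPINE with honest bookkeeping ω−2 = (h−1)+(ω−1−h), h : (refuter refuter-rreview-route-AtomisticToContinu-2de8a21e-0, 2026-08-15T14:00:12Z; prior: Strassen1988 spectrum of matrix shapes (J. reine angew. Math. 384), doi:10.1016/0304-3975(83)90054-3, doi:10.1006/jcom.1998.0476, doi:10.1006/jcom.1997.0438, arXiv:1204.1111, doi:10.1007/s00037-025-00264-9)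

History (route lifecycle, newest last):
- 2026-08-15T16:28:40Z · rev 1: restated Thesis (stmt-MatrixMultiplication-7241), PerfectAmortisation (stmt-MatrixMultiplication-7242), FaceMaximiser (stmt-MatrixMultiplication-7243), RectExponentTwoEqThree (stmt-MatrixMultiplication-7245), Converse (stmt-MatrixMultiplication-7246), Dichotomy (stmt-MatrixMultiplication-7247), RungTwoConsequenc (planner-rbadge-MatrixMultiplication-EPRFaces-159198fd-g2-0)
- 2026-08-17T08:48:57Z · BROKEN — ModuleRankGrowth (stmt-MatrixMultiplication-7244, crux) refuted by Summit.MatrixMultiplication.MatrixMultiplication.Theorems.PerfectAmortisation.not_ModuleRankGrowth @ 2009657905d4 (prover-line-stmt-MatrixMultiplication-10893-c1-0)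
- 2026-08-17T09:14:36Z · rev 2: dropped ModuleRankGrowth — repair (route-repair seat): drop ModuleRankGrowth (stmt-MatrixMultiplication-7244) — refuted-substantive by Summit.MatrixMultiplication.MatrixMultiplication.The (planner-rfix-MatrixMultiplication-EPRFaces-159198fd-0)
- 2026-08-17T09:14:36Z · REPAIRED (drop ModuleRankGrowth) — back to open: repair (route-repair seat): drop ModuleRankGrowth (stmt-MatrixMultiplication-7244) — refuted-substantive by Summit.MatrixMultiplication.MatrixMultiplication.The (planner-rfix-MatrixMultiplication-EPRFaces-159198fd-0)
- 2026-08-17T09:48:38Z · skeleton.hides-summit: stub_faceAtTwo (stmt-MatrixMultiplication-10894) ⟷ summit (accepted theorem in Summits/MatrixMultiplication/MatrixMultiplication/Theorems/EPRFacesFaceMaximiserSummitEquivalence.lean) (prover-line-stmt-MatrixMultiplication-10894-c1-0)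
- 2026-08-17T10:04:18Z · CLOSED exhausted — exhausted (planner-rbadge-MatrixMultiplication-EPRFaces-159198fd-g3-0)

sub-problem: MatrixMultiplication · status: closed(exhausted) · opened planner-plancard-MatrixMultiplication-MatrixM-22550238-0 2026-08-15T12:05:41Z · rev 3 · ledger route-MatrixMultiplication-EPRFaces
GENERATED by the gate from the ledger (D-0016/17). Provers cite these decls: `theorem foo : Summit.MatrixMultiplication.MatrixMultiplication.Theses.EPRFaces.<Decl> := …` in Summits/MatrixMultiplication/MatrixMultiplication/Theorems/<Name>.lean.
-/

namespace Summit.MatrixMultiplication.MatrixMultiplication.Theses.EPRFaces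

open scoped BigOperators Topology Manifold Classical MeasureTheory ProbabilityTheory Matrix InnerProductSpace ComplexConjugate ContinuousMap
open Filter Set Function TopologicalSpace MeasureTheory

attribute [summit_statement] _root_.MatrixMultiplication

-- earlier Thesis (stmt-MatrixMultiplication-7241, replaced 2026-08-15T16:28:40Z -> stmt-MatrixMultiplication-10892): retired by None — (∀ k : ℕ, 1 ≤ k → Literature.Computability.AlgebraicComplexity.omega ℂ + ((k : ℝ) - 1) ≤ Literature.Computability.AlgebraicComplexity.omegaRect ℂ 1 1 (k : ℝ)) ∧ (∀ ε : ℝ, 0 < ε → ∃ k : ℕ, 1 ≤ k ∧ Literature.Computability.AlgebraicComplexity.omegaRect ℂ 1 1 (k : ℝ) ≤ 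
/-- item stmt-MatrixMultiplication-10892 · target · rank 0 · closed · moot by None · by planner
why it might fail: ω > 2 makes at least one of B, E false (ω − 2 = e(∞) + d) and nobody knows which: an interior dark maximiser kills B, a module bound R(⟨n,n,N⟩) ≥ n^{1+c}·N kills E.
sources: Strassen1988, LeGall2012, BurgisserClausenShokrollahi1997
[target] X = B ∧ E in rank form (R(⟨n,n,n^k⟩) := tensorRank (matMulTensor ℂ n n (n^k)); β admissible
:= R = O(n^β); ω(1,1,k) = inf admissible β = omegaRect ℂ 1 1 k): (B) for every natural k ≥ 1 and
every admissible β for (1,1,k), ω_ℂ + (k − 1) ≤ β (⟺ ω + (k − 1) ≤ ω(1,1,k)); (E) for every ε > 0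
some natural k ≥ 1 has k + 1 + ε admissible for (1,1,k) (⟺ inf_k [ω(1,1,k) − k − 1] = 0). Literally
FaceMaximiser ∧ PerfectAmortisation. -/
@[route_item "route-MatrixMultiplication-EPRFaces"]
def Thesis : Prop :=
  (∀ k : ℕ, 1 ≤ k → ∀ β : ℝ, ((fun n : ℕ => (Literature.Computability.AlgebraicComplexity.tensorRank (Literature.Computability.AlgebraicComplexity.matMulTensor ℂ n n (n ^ k)) : ℝ)) =O[Filter.atTop] fun n : ℕ => (n : ℝ) ^ β) → Literature.Computability.AlgebraicComplexity.omega ℂ + ((k : ℝ) - 1) ≤ β) ∧ (∀ ε : ℝ, 0 < ε → ∃ k : ℕ, 1 ≤ k ∧ (fun n : ℕ => (Literature.Computability.AlgebraicComplexity.tensorRank (Literature.Computability.AlgebraicComplexity.matMulTensor ℂ n n (n ^ k)) : ℝ)) =O[Filter.atTop] fun n : ℕ => (n : ℝ) ^ ((k : ℝ) + 1 + ε))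

-- earlier PerfectAmortisation (stmt-MatrixMultiplication-7242, replaced 2026-08-15T16:28:40Z -> stmt-MatrixMultiplication-10893): retired by None — ∀ ε : ℝ, 0 < ε → ∃ k : ℕ, 1 ≤ k ∧ Literature.Computability.AlgebraicComplexity.omegaRect ℂ 1 1 (k : ℝ) ≤ (k : ℝ) + 1 + ε
/-- item stmt-MatrixMultiplication-10893 · crux · rank 2 · closed · proved by Summit.MatrixMultiplication.MatrixMultiplication.Theorems.PerfectAmortisation.perfectAmortisation_proof @ a58f4dd2b2be (prover) · by planner
why it might fail: best certified excess is e(3) ≤ 0.198809 (VXXZ2024 Table 1; ≈ 0.167 at k = 5, LeGall2012) and fixed-q CW_q analyses may bottom out at c_q > 0; a module bound R(⟨n,n,N⟩) ≥ n^{1+c}·N (crux ModuleRankGrowth) refutes it, and ω = 2 with it.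
sources: LeGall2012, LeGallUrrutia2018, VassilevskaWilliamsXuXuZhou2024, LottiRomani1983, doi:10.1006/jcom.1998.0476
[crux] E, the card's face statement in form (i): e(∞) = lim_k [ω(1,1,k) − k − 1] = 0, filed in RANK
FORM as ∀ ε > 0 ∃ k ≥ 1, R(⟨n,n,n^k⟩) = O(n^{k+1+ε}) with R(⟨n,n,n^k⟩) = tensorRank (matMulTensor ℂ
n n (n^k)); equivalent to ∀ ε ∃ k, ω(1,1,k) ≤ k + 1 + ε (ω(1,1,k) = omegaRect ℂ 1 1 k is the inf of
exactly these β since ⌈n^k⌉ = n^k; the ε-slack is absorbed by the quantifiers; e(k) ≥ 0 and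
nonincreasing by add_one_le_omegaRect_one_mid_one, omegaRect_one_mid_one, omegaRect_one_one_le_add,
so lim = inf = 0). Equivalent forms: the module rank / border rank per vector ρ(n), β(n) are
n^{1+o(1)} (log_n β(n) ≥ 1 + e(∞) for every n by a tensor-power argument); no universal spectral
point on a side face of Strassen's chart beyond the base edge (h = 1). [difficulty: open-problem] -/
@[route_item "route-MatrixMultiplication-EPRFaces"]
def PerfectAmortisation : Prop :=
  ∀ ε : ℝ, 0 < ε → ∃ k : ℕ, 1 ≤ k ∧ (fun n : ℕ => (Literature.Computability.AlgebraicComplexity.tensorRank (Literature.Computability.AlgebraicComplexity.matMulTensor ℂ n n (n ^ k)) : ℝ)) =O[Filter.atTop] fun n : ℕ => (n : ℝ) ^ ((k : ℝ) + 1 + ε)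

-- earlier FaceMaximiser (stmt-MatrixMultiplication-7243, replaced 2026-08-15T16:28:40Z -> stmt-MatrixMultiplication-10894): retired by None — ∀ k : ℕ, 1 ≤ k → Literature.Computability.AlgebraicComplexity.omega ℂ + ((k : ℝ) - 1) ≤ Literature.Computability.AlgebraicComplexity.omegaRect ℂ 1 1 (k : ℝ)
/-- item stmt-MatrixMultiplication-10894 · crux · rank 3 · closed · moot by None · by planner
why it might fail: if ω > 2 every maximiser may be interior (dark points undercounting all three EPR pairs); B forces ω ≤ 1 + (u_k − k) ≤ 2.198809 (vendored k = 3 row), so B is false once ω > 2.1989, and no lossless square←rectangular transfer is known.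
sources: Strassen1988, Strassen1991, BurgisserClausenShokrollahi1997, doi:10.1006/jcom.1998.0476, VassilevskaWilliamsXuXuZhou2024
[crux] B in RANK FORM: for every natural k ≥ 1 and every real β with R(⟨n,n,n^k⟩) = O(n^β) (R =
tensorRank of matMulTensor ℂ n n (n^k)), ω_ℂ + (k − 1) ≤ β; equivalent to ω + (k − 1) ≤ ω(1,1,k)
(le_csInf / csInf_le: rectAdmissibleExponents nonempty and bounded below, both in tree; the reverse
inequality is blocking, omegaRect_one_one_le_add): ⟨n,n,n^k⟩ has no asymptotic economy over n^{k−1}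
square products, d = 0. Chart form (support SpectralFaceForm): some universal spectral point F with
F(⟨2,2,2⟩) = 2^ω (a maximiser) has F(⟨1,1,2⟩) = 2, i.e. lies on the EPR face l₃ = 1. By convexity
(omegaRect_convexOn_middle_holds, proved) the single value k = 2, ω(1,1,2) = ω + 1, already gives
all k. [difficulty: open-problem] -/
@[route_item "route-MatrixMultiplication-EPRFaces"]
def FaceMaximiser : Prop :=
  ∀ k : ℕ, 1 ≤ k → ∀ β : ℝ, ((fun n : ℕ => (Literature.Computability.AlgebraicComplexity.tensorRank (Literature.Computability.AlgebraicComplexity.matMulTensor ℂ n n (n ^ k)) : ℝ)) =O[Filter.atTop] fun n : ℕ => (n : ℝ) ^ β) → Literature.Computability.AlgebraicComplexity.omega ℂ + ((k : ℝ) - 1) ≤ β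

-- earlier RectExponentTwoEqThree (stmt-MatrixMultiplication-7245, replaced 2026-08-15T16:28:40Z -> stmt-MatrixMultiplication-10895): retired by None — Literature.Computability.AlgebraicComplexity.omegaRect ℂ 1 1 2 ≤ 3
/-- item stmt-MatrixMultiplication-10895 · crux · rank 5 · closed · moot by None · by planner
why it might fail: the record is ω(1,2,1) ≤ 3.250035 (ADVXXZ2025 Table 1); CLLZ Table 1 bars every CW_q T-method, q ≤ 14, below 3.0626, so a non-CW carrier is needed; and it forces ω ≤ 2.25, below everything certified so far.
sources: AlmanDuanVassilevskaWilliamsXuXuZhou2025, ChristandlLeGallLysikovZuiddam2025, LeGall2012, doi:10.1006/jcom.1998.0476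
[crux] the k = 2 rung of the card's ladder in RANK FORM: ∀ ε > 0, R(⟨n,n,n²⟩) = O(n^{3+ε}) (R =
tensorRank of matMulTensor ℂ n n (n^2)); equivalent to ω_ℂ(1,1,2) ≤ 3 (hence = 3 by flattening),
i.e. R̃(⟨2,2,4⟩) = 8 (asymptoticRank_matMulTensor_rect): an n × n by n × n² product in n^{3+o(1)}
operations. Implies E (e(2) = 0, k = 2) and ω ≤ 9/4 by the asymptotic sum inequality for the single
summand (support RungTwoConsequences); together with B it gives ω = 2. [difficulty: open-problem] -/
@[route_item "route-MatrixMultiplication-EPRFaces"]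
def RectExponentTwoEqThree : Prop :=
  ∀ ε : ℝ, 0 < ε → (fun n : ℕ => (Literature.Computability.AlgebraicComplexity.tensorRank (Literature.Computability.AlgebraicComplexity.matMulTensor ℂ n n (n ^ 2)) : ℝ)) =O[Filter.atTop] fun n : ℕ => (n : ℝ) ^ ((3 : ℝ) + ε)

-- earlier Converse (stmt-MatrixMultiplication-7246, replaced 2026-08-15T16:28:40Z -> stmt-MatrixMultiplication-10896): retired by None — MatrixMultiplication → ((∀ k : ℕ, 1 ≤ k → Literature.Computability.AlgebraicComplexity.omega ℂ + ((k : ℝ) - 1) ≤ Literature.Computability.AlgebraicComplexity.omegaRect ℂ 1 1 (k : ℝ)) ∧ (∀ ε : ℝ, 0 < ε → ∃ k : ℕ, 1 ≤ k ∧ Literature.Computability.AlgebraicComplexity.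
/-- item stmt-MatrixMultiplication-10896 · support · rank 9 · closed · proved by Summit.MatrixMultiplication.MatrixMultiplication.Theorems.converse_proof @ 141c5e4fb5a7 (prover) · by planner
sources: LeGall2012, Blaser2013
[support] ω = 2 → B ∧ E (rank forms; the factorisation loses nothing). B: the flattening bound
R(⟨n,n,n^k⟩) ≥ n·n^k = n^{k+1} (FlatteningBound: mul_le_tensorRank_matMulTensor family) forces every
admissible β ≥ k + 1 = ω + k − 1 (as in admissibleExponents_two_le); E with k = 1: ω = inf
admissibleExponents = 2 gives an admissible β < 2 + ε (exists_lt_of_csInf_lt,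
admissibleExponents_nonempty), hence 2 + ε admissible (upward closure), reindexed along n^1 = n
(tensorRank_matMulTensor_congr). [difficulty: provable-now] -/
@[route_item "route-MatrixMultiplication-EPRFaces"]
def Converse : Prop :=
  MatrixMultiplication → ((∀ k : ℕ, 1 ≤ k → ∀ β : ℝ, ((fun n : ℕ => (Literature.Computability.AlgebraicComplexity.tensorRank (Literature.Computability.AlgebraicComplexity.matMulTensor ℂ n n (n ^ k)) : ℝ)) =O[Filter.atTop] fun n : ℕ => (n : ℝ) ^ β) → Literature.Computability.AlgebraicComplexity.omega ℂ + ((k : ℝ) - 1) ≤ β) ∧ (∀ ε : ℝ, 0 < ε → ∃ k : ℕ, 1 ≤ k ∧ (fun n : ℕ => (Literature.Computability.AlgebraicComplexity.tensorRank (Literature.Computability.AlgebraicComplexity.matMulTensor ℂ n n (n ^ k)) : ℝ)) =O[Filter.atTop] fun n : ℕ => (n : ℝ) ^ ((k : ℝ) + 1 + ε)))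

-- earlier Dichotomy (stmt-MatrixMultiplication-7247, replaced 2026-08-15T16:28:40Z -> stmt-MatrixMultiplication-10897): retired by None — Literature.Computability.AlgebraicComplexity.vxxz2024_omegaRect_table → (∀ k : ℕ, 1 ≤ k → Literature.Computability.AlgebraicComplexity.omega ℂ + ((k : ℝ) - 1) ≤ Literature.Computability.AlgebraicComplexity.omegaRect ℂ 1 1 (k : ℝ)) → Literature.Computability.Algebr
/-- item stmt-MatrixMultiplication-10897 · support · rank 9 · closed · proved by Summit.MatrixMultiplication.MatrixMultiplication.Theorems.dichotomy_proof @ de47d04115d5 (prover) · by planner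
sources: VassilevskaWilliamsXuXuZhou2024, LeGall2012
[support] the card's dichotomy lemma, record-free: IF the VXXZ2024 row κ = 3 holds in rank form (∀ ε
> 0, R(⟨n,n,n³⟩) = O(n^{4.198809+ε}), i.e. ω(1,1,3) ≤ 4.198809 — exactly the content of
vxxz2024_omegaRect_table's row (3, 4.198809) via omegaRect_one_mid_one, kept here as an EXPLICIT
hypothesis so that no vendored table enters the route's cone) and B holds, then ω ≤ 2.198809 (B at k
= 3, β = 4.198809 + ε, ε → 0); contrapositively ω > 2.1989 forces every ω-maximising spectral point
to be interior. Sorry-free in Sketch.lean (le_of_forall_pos_lt_add + linarith). [difficulty: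
provable-now] -/
@[route_item "route-MatrixMultiplication-EPRFaces"]
def Dichotomy : Prop :=
  (∀ ε : ℝ, 0 < ε → (fun n : ℕ => (Literature.Computability.AlgebraicComplexity.tensorRank (Literature.Computability.AlgebraicComplexity.matMulTensor ℂ n n (n ^ 3)) : ℝ)) =O[Filter.atTop] fun n : ℕ => (n : ℝ) ^ ((4.198809 : ℝ) + ε)) → (∀ k : ℕ, 1 ≤ k → ∀ β : ℝ, ((fun n : ℕ => (Literature.Computability.AlgebraicComplexity.tensorRank (Literature.Computability.AlgebraicComplexity.matMulTensor ℂ n n (n ^ k)) : ℝ)) =O[Filter.atTop] fun n : ℕ => (n : ℝ) ^ β) → Literature.Computability.AlgebraicComplexity.omega ℂ + ((k : ℝ) - 1) ≤ β) → Literature.Computability.AlgebraicComplexity.omega ℂ ≤ 2.198809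

-- earlier RungTwoConsequences (stmt-MatrixMultiplication-7248, replaced 2026-08-15T16:28:40Z -> stmt-MatrixMultiplication-10898): retired by None — Literature.Computability.AlgebraicComplexity.omegaRect ℂ 1 1 2 ≤ 3 → Literature.Computability.AlgebraicComplexity.omega ℂ ≤ 9 / 4 ∧ (∀ ε : ℝ, 0 < ε → ∃ k : ℕ, 1 ≤ k ∧ Literature.Computability.AlgebraicComplexity.omegaRect ℂ 1 1 (k : ℝ) ≤ (k : ℝ) + 1 + ε)
/-- item stmt-MatrixMultiplication-10898 · support · rank 9 · closed · proved by Summit.MatrixMultiplication.MatrixMultiplication.Theorems.rungTwoConsequences_proof @ 0d3644d1b193 (prover) · by planner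
sources: AlmanDuanVassilevskaWilliamsXuXuZhou2025, Blaser2013
[support] rung → ω ≤ 9/4 ∧ E (rank forms): from R(⟨n,n,n²⟩) = O(n^{3+ε}) and the single-summand
asymptotic sum inequality (n·n·n²)^{ω/3} ≤ R̃(⟨n,n,n²⟩) ≤ R(⟨n,n,n²⟩) (tree:
sum_rpow_omega_le_asymptoticRank, the ⟨k,m,n⟩ version of
tensorRestrictsTo_matMulTensor_matMulDirectSum_one, asymptoticRank ≤ tensorRank) get n^{4ω/3} ≤ C
n^{3+ε} for large n, so 4ω/3 ≤ 3 + ε for every ε and ω ≤ 9/4; the E-half is the rung itself at k = 2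
((2 : ℕ) + 1 + ε = 3 + ε, checked in Sketch.lean). [difficulty: M] -/
@[route_item "route-MatrixMultiplication-EPRFaces"]
def RungTwoConsequences : Prop :=
  (∀ ε : ℝ, 0 < ε → (fun n : ℕ => (Literature.Computability.AlgebraicComplexity.tensorRank (Literature.Computability.AlgebraicComplexity.matMulTensor ℂ n n (n ^ 2)) : ℝ)) =O[Filter.atTop] fun n : ℕ => (n : ℝ) ^ ((3 : ℝ) + ε)) → Literature.Computability.AlgebraicComplexity.omega ℂ ≤ 9 / 4 ∧ (∀ ε : ℝ, 0 < ε → ∃ k : ℕ, 1 ≤ k ∧ (fun n : ℕ => (Literature.Computability.AlgebraicComplexity.tensorRank (Literature.Computability.AlgebraicComplexity.matMulTensor ℂ n n (n ^ k)) : ℝ)) =O[Filter.atTop] fun n : ℕ => (n : ℝ) ^ ((k : ℝ) + 1 + ε))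

-- earlier ModuleGrowthRefutes (stmt-MatrixMultiplication-7249, replaced 2026-08-15T16:28:40Z -> stmt-MatrixMultiplication-10899): retired by None — (∃ c : ℝ, 0 < c ∧ ∃ n₀ : ℕ, ∀ n : ℕ, n₀ ≤ n → ∃ N₀ : ℕ, ∀ N : ℕ, N₀ ≤ N → (n : ℝ) ^ (1 + c) * (N : ℝ) ≤ (Literature.Computability.AlgebraicComplexity.tensorRank (Literature.Computability.AlgebraicComplexity.matMulTensor ℂ n n N) : ℝ)) → (¬ (∀ ε : ℝ, 0 < 
/-- item stmt-MatrixMultiplication-10899 · support · rank 9 · closed · proved by Summit.MatrixMultiplication.MatrixMultiplication.Theorems.ModuleGrowthRefutes_proof @ 46997ff96d8d (prover) · by planner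
sources: Blaser2013, LeGall2012
[support] ModuleRankGrowth → ¬E ∧ ¬(ω = 2), E in rank form: at FIXED n ≥ n₀ split the last slot,
R(⟨n,n,N⟩) ≤ ⌈N/n^k⌉·R(⟨n,n,n^k⟩) (rotate the tree's tensorRank_matMulTensor_split_middle, or direct
sum + tensorRank_add_le + monotonicity), so an admissible β for (1,1,k) gives n^{1+c}·N ≤ (N/n^k +
1)·C n^β for all large N; N → ∞ then n → ∞ along the O-bound give β ≥ k + 1 + c for every k with the
same c; ε := c/2 contradicts E, and k = 1 bounds every admissible exponent of ω below by 2 + c, so ω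
≥ 2 + c and ω ≠ 2 (quantifier order paper-checked by refuter g41-47). [difficulty: M] -/
@[route_item "route-MatrixMultiplication-EPRFaces"]
def ModuleGrowthRefutes : Prop :=
  (∃ c : ℝ, 0 < c ∧ ∃ n₀ : ℕ, ∀ n : ℕ, n₀ ≤ n → ∃ N₀ : ℕ, ∀ N : ℕ, N₀ ≤ N → (n : ℝ) ^ (1 + c) * (N : ℝ) ≤ (Literature.Computability.AlgebraicComplexity.tensorRank (Literature.Computability.AlgebraicComplexity.matMulTensor ℂ n n N) : ℝ)) → (¬ (∀ ε : ℝ, 0 < ε → ∃ k : ℕ, 1 ≤ k ∧ (fun n : ℕ => (Literature.Computability.AlgebraicComplexity.tensorRank (Literature.Computability.AlgebraicComplexity.matMulTensor ℂ n n (n ^ k)) : ℝ)) =O[Filter.atTop] fun n : ℕ => (n : ℝ) ^ ((k : ℝ) + 1 + ε))) ∧ ¬ MatrixMultiplication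

-- earlier SpectralFaceForm (stmt-MatrixMultiplication-7250, replaced 2026-08-15T16:28:40Z -> stmt-MatrixMultiplication-10900): retired by None — (∃ F : Literature.Computability.AlgebraicComplexity.SpectralMap ℂ, Literature.Computability.AlgebraicComplexity.IsUniversalSpectralPoint ℂ F ∧ F (Literature.Computability.AlgebraicComplexity.matMulTensor ℂ 2 2 2) = (2 : ℝ) ^ Literature.Computability.Algebra
/-- item stmt-MatrixMultiplication-10900 · support · rank 9 · closed · proved by Summit.MatrixMultiplication.MatrixMultiplication.Theorems.spectralFaceForm_proof @ 6acdbb9b5838 (prover) · by planner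
sources: Strassen1988, ChristandlVranaZuiddam2023, AlmanDuanVassilevskaWilliamsXuXuZhou2025
[support] the chart dictionary for B, with B in rank form: (∃ a universal spectral point F over ℂ
with F(⟨2,2,2⟩) = 2^ω and F(⟨1,1,2⟩) = 2) ↔ B. (→) F(⟨2^m,2^m,2^{mk}⟩) =
(F(⟨2,2,2⟩)·F(⟨1,1,2⟩)^{k−1})^m = 2^{m(ω+k−1)} by multiplicativity and reindexing
(kroneckerTensor_matMulTensor, eq_of_restrictsTo), and F ≤ R̃ ≤ R
(strassen_duality_asymptoticRank_holds part 1, asymptoticRank ≤ tensorRank), so an admissible β for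
(1,1,k) satisfies 2^{m(ω+k−1)} ≤ C·(2^m)^β for large m, whence ω + k − 1 ≤ β; (←) duality part 2
gives a maximiser F at ⟨2,2,4⟩ with F(⟨2,2,4⟩) = R̃(⟨2,2,4⟩) = 2^{ω(1,1,2)} ≥ 2^{ω+1} under B
(asymptoticRank_matMulTensor_rect and B ⟹ ω(1,1,2) ≥ ω + 1), while F(⟨2,2,4⟩) =
F(⟨2,2,2⟩)·F(⟨1,1,2⟩) ≤ 2^ω·2 (F ≤ R̃(⟨2,2,2⟩) = 2^ω, F(⟨1,1,2⟩) ≤ R(⟨1,1,2⟩) = 2), forcing both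
equalities. IsUniversalSpectralPoint ℂ is inhabited (gauge points / duality, proved), so the ∃ side
is not vacuous. [difficulty: M] -/
@[route_item "route-MatrixMultiplication-EPRFaces"]
def SpectralFaceForm : Prop :=
  (∃ F : Literature.Computability.AlgebraicComplexity.SpectralMap ℂ, Literature.Computability.AlgebraicComplexity.IsUniversalSpectralPoint ℂ F ∧ F (Literature.Computability.AlgebraicComplexity.matMulTensor ℂ 2 2 2) = (2 : ℝ) ^ Literature.Computability.AlgebraicComplexity.omega ℂ ∧ F (Literature.Computability.AlgebraicComplexity.matMulTensor ℂ 1 1 2) = 2) ↔ (∀ k : ℕ, 1 ≤ k → ∀ β : ℝ, ((fun n : ℕ => (Literature.Computability.AlgebraicComplexity.tensorRank (Literature.Computability.AlgebraicComplexity.matMulTensor ℂ n n (n ^ k)) : ℝ)) =O[Filter.atTop] fun n : ℕ => (n : ℝ) ^ β) → Literature.Computability.AlgebraicComplexity.omega ℂ + ((k : ℝ) - 1) ≤ β)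

/-- item stmt-MatrixMultiplication-7251 · assembly · rank 1 · closed · proved by Summit.MatrixMultiplication.MatrixMultiplication.Theorems.eprFaces_assembly_proof @ be0f49fdb05a (prover) · by planner
sources: LeGall2012, Blaser2013
[assembly] FaceMaximiser → PerfectAmortisation → ω(ℂ) = 2. -/
@[route_item "route-MatrixMultiplication-EPRFaces"]
def Assembly : Prop :=
  FaceMaximiser → PerfectAmortisation → MatrixMultiplication

-- records of items no longer active in this route (dropped / restated):
-- earlier ModuleRankGrowth (stmt-MatrixMultiplication-7244, dropped 2026-08-17T09:14:36Z): refuted by Summit.MatrixMultiplication.MatrixMultiplication.Theorems.PerfectAmortisation.not_ModuleRankGrowth @ 2009657905d4 — ∃ c : ℝ, 0 < c ∧ ∃ n₀ : ℕ, ∀ n : ℕ, n₀ ≤ n → ∃ N₀ : ℕ, ∀ N : ℕ, N₀ ≤ N → (n : ℝ) ^ (1 + c) * (N : ℝ) ≤ (Literature.Computability.AlgebraicComplexity.tensorRank (Literature.Computabilit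

end Summit.MatrixMultiplication.MatrixMultiplication.Theses.EPRFaces
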